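import Summits.Ventures.YMGap.YM3IR.Statement
import Summits.Ventures.YMGap.RobustBall.Defs
import HarnessLib

/-!
# YM₃ infrared statement — `YM3IR/BallInstance.lean`: Y2's ball AS the `BallSpec` of `T_IR`
(cell `pub-ymgap`, track Y4 ↔ track Y2; ym3ir-theory-2)

HONEST FRAMING. Bookkeeping only: this file instantiates part 1's abstract ball interface
`BallSpec G N` by track Y2's tier-2 ball `RobustBall.ClusterDomain κ ε₀ ε₁` (and, second instance, its
tier-1 ball `RobustBall.ClusterDomainFR ε₀ ε₁ r`) on `SU(N)` with the
fundamental representation (the instantiation sentence agreed by ym3ir-theory-1 / rb-theory,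
2026-08-22 19:07Z), and PROVES that Y2's conclusion predicate `RobustBall.TorusClusteringOnBallW`
— asked with ONE constant for all Wilson-part couplings `0 ≤ β' ≤ β⋆` (tier 1: rb-theory's NAMED
receiving currency `RobustBall.TorusClusteringOnBallUpTo`) — is exactly the hypothesis
`ClusterDomainClustering` that the composition `massGap3Cofinal_of` (`YM3IR/Statement.lean`)
consumes, in the link metric `suFrobDist`; plus the bounded-link-weight premise of `DecayTransfer`
for that metric (`suFrobDist ≤ 2√N`, tree); and it records the COMPOSITION of `YM3IR/Statement.lean`
instantiated on these balls (`massGap3Cofinal_SUN_of`, `massGap3Cofinal_SUN_upTo_of`): Bałaban's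
`BalabanUV3` ∧ Y2's torus clustering on the ball ∧ `T_IR` ⟹ `MassGap3Cofinal I suFrobDist ρ_fund` —
PROVED glue in which every non-printed input is a NAMED hypothesis (nothing is discharged here).
Nothing here asserts that Y2's rows reach any particular `(κ, ε₀, ε₁, β⋆)`: that is track Y2's
theorem (declared cruxes Y2-X1a/b, tree `RobustBall/Targets.lean`), entering only as the
hypotheses `h` / `hY2` below; nothing asserts `BalabanUV3` or `T_IR`. No axiom, no `sorry`.

## References

* H. Föllmer, LNM 1362 (1988) Ch. I, Cor. (2.14)/(2.24) (the weighted Dobrushin–KR engine behind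
  Y2's tier-2 door). [cite: Follmer1988]
* K. Osterwalder, E. Seiler, Ann. Phys. 110 (1978) 440, §3 (the Wilson member). [cite: OsterwalderSeilerAnnPhys1978]
-/

noncomputable section

open MeasureTheory ProbabilityTheory
open Literature.MathematicalPhysics.QuantumLattice Literature.MathematicalPhysics.QuantumFieldTheory

namespace Summit.Ventures.YMGap.YM3IR

/-- **Y2's tier-2 ball as a `BallSpec`:** group `SU(N)`, fundamental representation in the Wilson
part, Wilson-part ceiling `β⋆`, membership `W ∈ RobustBall.ClusterDomain κ ε₀ ε₁` (κ-weighted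
per-link oscillation and Lipschitz loads). [folklore] -/
def ballOfRobustBall (N : ℕ) (κ ε₀ ε₁ βstar : ℝ) : BallSpec (RobustBall.SUN N) N where
  ρ := fundamentalRep (Fin N)
  βstar := βstar
  InBall M _ W := W ∈ RobustBall.ClusterDomain (d := 3) (L := M) (N := N) κ ε₀ ε₁

/-- **Y2 ⟹ H_RB (PROVED bookkeeping).** Tier-2 torus clustering on the ball with ONE constant `A` and
ONE rate `m` for every Wilson-part coupling `0 ≤ β' ≤ β⋆` is `ClusterDomainClustering` for the
instantiated ball in the metric `suFrobDist` (the two `ClustersWith` bodies agree up to the order of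
the two load sums). -/
theorem clusterDomainClustering_of_torusClusteringOnBallW {N : ℕ} {κ ε₀ ε₁ βstar A m : ℝ}
    (h : ∀ β' : ℝ, 0 ≤ β' → β' ≤ βstar →
      RobustBall.TorusClusteringOnBallW N 3 β' κ ε₀ ε₁ A m) :
    ClusterDomainClustering (ballOfRobustBall N κ ε₀ ε₁ βstar) suFrobDist m := by
  refine ⟨A, fun M _ hM μ hμ => ?_⟩
  obtain ⟨β', h0, hle, W, hW, rfl⟩ := hμ
  intro f g Δf Δg δf δg n hf hg hdf hdg hbf hbg hlf hlg hn
  have key := h β' h0 hle M hM W hW f g Δf Δg δf δg n hf hg hdf hdg hbf hbg hlf hlg hn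
  calc |cov[f, g; W.perturbedMeasure (fundamentalRep (Fin N)) β']|
      ≤ A * (∑ y ∈ Δg, δg y) * (∑ x ∈ Δf, δf x) * Real.exp (-m * n) := key
    _ = A * (∑ x ∈ Δf, δf x) * (∑ y ∈ Δg, δg y) * Real.exp (-m * n) := by ring

/-- **Y2's tier-1 ball as a `BallSpec`:** membership `W ∈ RobustBall.ClusterDomainFR ε₀ ε₁ r`
(finite range `r`, plain oscillation / Lipschitz loads) — the ball of rb-theory's receiving currency
`RobustBall.TorusClusteringOnBallUpTo`. [folklore] -/
def ballOfRobustBallFR (N : ℕ) (ε₀ ε₁ : ℝ) (r : ℕ) (βstar : ℝ) : BallSpec (RobustBall.SUN N) N where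
  ρ := fundamentalRep (Fin N)
  βstar := βstar
  InBall M _ W := W ∈ RobustBall.ClusterDomainFR (d := 3) (L := M) (N := N) ε₀ ε₁ r

/-- **Y2 (tier 1, BY NAME) ⟹ H_RB (PROVED bookkeeping).** rb-theory's receiving currency
`RobustBall.TorusClusteringOnBallUpTo N 3 β⋆ ε₀ ε₁ r A m` (clustering on the tier-1 ball at every
Wilson-part coupling `0 ≤ β' ≤ β⋆`, one constant, one rate) is `ClusterDomainClustering` for the
tier-1 instantiated ball in the metric `suFrobDist`. -/
theorem clusterDomainClustering_of_torusClusteringOnBallUpTo {N : ℕ} {ε₀ ε₁ βstar A m : ℝ}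
    {r : ℕ} (h : RobustBall.TorusClusteringOnBallUpTo N 3 βstar ε₀ ε₁ r A m) :
    ClusterDomainClustering (ballOfRobustBallFR N ε₀ ε₁ r βstar) suFrobDist m := by
  refine ⟨A, fun M _ hM μ hμ => ?_⟩
  obtain ⟨β', h0, hle, W, hW, rfl⟩ := hμ
  intro f g Δf Δg δf δg n hf hg hdf hdg hbf hbg hlf hlg hn
  have key := h β' h0 hle M hM W hW f g Δf Δg δf δg n hf hg hdf hdg hbf hbg hlf hlg hn
  calc |cov[f, g; W.perturbedMeasure (fundamentalRep (Fin N)) β']|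
      ≤ A * (∑ y ∈ Δg, δg y) * (∑ x ∈ Δf, δf x) * Real.exp (-m * n) := key
    _ = A * (∑ x ∈ Δf, δf x) * (∑ y ∈ Δg, δg y) * Real.exp (-m * n) := by ring

/-- The link metric `suFrobDist` is bounded above (`≤ 2√N`, tree `suFrobDist_le`): the premise of
`DecayTransfer` / `massGap3Cofinal_of` for Y2's metric. -/
theorem suFrobDist_bddAbove (N : ℕ) :
    ∃ D : ℝ, ∀ a b : RobustBall.SUN N, suFrobDist a b ≤ D :=
  ⟨2 * Real.sqrt N, suFrobDist_le⟩


/-! ## The Y4 composition on Y2's balls (PROVED glue; all three inputs are NAMED hypotheses) -/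

/-- **`SU(N)` lattice YM₃ mass gap, cofinal form, from the three named inputs on Y2's tier-2 ball
(PROVED glue).** For the fundamental representation of `SU(N)`, an unbounded coupling set `I`, and
positive bookkeeping constants: Bałaban's ultraviolet stability `BalabanUV3 mk` (PRINTED, CMP 102
Thm 2, entering by name), Y2's torus clustering on the tier-2 ball at every Wilson-part coupling
`0 ≤ β' ≤ β⋆` with one constant and one rate `m_c` (track Y2's theorem-to-be, hypothesis `hY2`), and
the infrared hypothesis `T_IR` for the instantiated ball (CONJECTURE (a) crossover + (b) fluctuation
decoupling + support (c) decay transfer) imply `MassGap3Cofinal I suFrobDist ρ_fund`: clustering at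
rate `min(m_c, κ)/(3 C_b β)` on the block family's tori, uniformly in the volume, at every `β ∈ I`.
One line from `massGap3Cofinal_of` (`YM3IR/Statement.lean`) and the adapters above; the only content
added is the instantiation `G := SU(N)`, `r := suFrobDist`, `B := ballOfRobustBall N κ ε₀ ε₁ β⋆`. -/
theorem massGap3Cofinal_SUN_of {N L : ℕ} {mk : Balaban1985CMP102.Theorems.Construction L}
    {κ ε₀ ε₁ βstar A : ℝ} {I : Set ℝ} {C_b κf m_c : ℝ}
    (hI : ¬ BddAbove I) (hC : 0 < C_b) (hκf : 0 < κf) (hm : 0 < m_c)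
    (hY2 : ∀ β' : ℝ, 0 ≤ β' → β' ≤ βstar →
      RobustBall.TorusClusteringOnBallW N 3 β' κ ε₀ ε₁ A m_c)
    (hUV : BalabanUV3 mk)
    (hIR : T_IR mk (ballOfRobustBall N κ ε₀ ε₁ βstar) suFrobDist (fundamentalRep (Fin N)) I C_b κf m_c) :
    MassGap3Cofinal I suFrobDist
      (fundamentalRep (Fin N) : RobustBall.SUN N →* Matrix (Fin N) (Fin N) ℂ) :=
  massGap3Cofinal_of hI hC hκf hm (suFrobDist_bddAbove N) hUV
    (clusterDomainClustering_of_torusClusteringOnBallW hY2) hIR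

/-- **The same composition on Y2's tier-1 ball, with rb-theory's receiving currency BY NAME
(PROVED glue):** `RobustBall.TorusClusteringOnBallUpTo N 3 β⋆ ε₀ ε₁ r A m_c` in place of `hY2`. -/
theorem massGap3Cofinal_SUN_upTo_of {N L : ℕ} {mk : Balaban1985CMP102.Theorems.Construction L}
    {ε₀ ε₁ βstar A : ℝ} {r : ℕ} {I : Set ℝ} {C_b κf m_c : ℝ}
    (hI : ¬ BddAbove I) (hC : 0 < C_b) (hκf : 0 < κf) (hm : 0 < m_c)
    (hY2 : RobustBall.TorusClusteringOnBallUpTo N 3 βstar ε₀ ε₁ r A m_c)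
    (hUV : BalabanUV3 mk)
    (hIR : T_IR mk (ballOfRobustBallFR N ε₀ ε₁ r βstar) suFrobDist (fundamentalRep (Fin N)) I C_b κf
      m_c) :
    MassGap3Cofinal I suFrobDist
      (fundamentalRep (Fin N) : RobustBall.SUN N →* Matrix (Fin N) (Fin N) ℂ) :=
  massGap3Cofinal_of hI hC hκf hm (suFrobDist_bddAbove N) hUV
    (clusterDomainClustering_of_torusClusteringOnBallUpTo hY2) hIR

end Summit.Ventures.YMGap.YM3IR

end
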